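import Summits.AnomalousDissipation.AnomalousDissipation.Theses.Sparks

/-!
# Re-glue certificate: route Sparks closes through `BallIgnition` (crux-strategist, 2026-08-17)

`sparksThesis_of_ballIgnition : BallIgnition → UniformIgnition → RecurrentBlowupBall → SparksThesis` — the route's target is
reachable from child 2 of the strategist's split ALONE (with the existing cruxes #5 and #4), bypassing the parent crux
`SingularitiesDissipate` and child 1 `BlowupIsL2Open`. Hence a tenure planner may file the support item
`BallIgnitionReturnGlue : BallIgnition → UniformIgnition → RecurrentBlowupBall → SparksThesis` (this theorem is its proof) and
re-certify `closes (hB : BallIgnition) (h₅ : UniformIgnition) (h₄ : RecurrentBlowupBall) (hg : BallIgnitionReturnGlue) (hA : Assembly) := hA (hg hB h₅ h₄)`.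

Proof: from `RecurrentBlowupBall` take `f, U₀, δ₂ < δ₁, T, E, Tr, ν₁`, the blow-up ball `B̄_{δ₁}(U₀)` and the deep return. Every
smooth div-free `V` with `‖V − U₀‖₂ ≤ δ₁' := (δ₁+δ₂)/2` is the centre of the blow-up ball of radius `(δ₁−δ₂)/2` (triangle
inequality in `L²`), so `BallIgnition` gives pointwise ignition at `V` with window `T + τ_V`; `UniformIgnition` with
`(δ₁', δ₂)` gives `(q, Tb, ν₀)` uniform on `B̄_{δ₂}(U₀)`; then as in `IgnitionReturnGlue`: `N : ℕ` with `Tb < N·Tr`, witnesses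
`S = {U₀}`, `δ = δ₂`, `Tr' = N·Tr`, `ν₀' = min ν₀ ν₁`; RETURN window `k` of length `N·Tr` contains window `k·N` of length `Tr`.
-/

set_option linter.dupNamespace false

noncomputable section

open Filter Set MeasureTheory Topology

namespace Summit.AnomalousDissipation.AnomalousDissipation.Cruxes.SingularitiesDissipate.ReGlue

open Summit.AnomalousDissipation.AnomalousDissipation.Theses.Sparks

/-- **Re-glue**: `BallIgnition → UniformIgnition → RecurrentBlowupBall → SparksThesis`. [bookkeeping] -/
theorem sparksThesis_of_ballIgnition :
    (∀ f : UnitAddTorus (Fin 3) → EuclideanSpace ℝ (Fin 3), Literature.Analysis.FunctionSpaces.Torus.IsSmooth f → Literature.Analysis.FunctionSpaces.Torus.IsDivFree f → Literature.Analysis.FunctionSpaces.Torus.HasZeroMean f → ∀ (U₀ : UnitAddTorus (Fin 3) → EuclideanSpace ℝ (Fin 3)), Literature.Analysis.FunctionSpaces.Torus.IsSmooth U₀ → Literature.Analysis.FunctionSpaces.Torus.IsDivFree U₀ → ∀ (r S : ℝ), 0 < r → 0 < S → (∀ (V : UnitAddTorus (Fin 3) → EuclideanSpace ℝ (Fin 3)),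 Literature.Analysis.FunctionSpaces.Torus.IsSmooth V → Literature.Analysis.FunctionSpaces.Torus.IsDivFree V → MeasureTheory.eLpNorm (V - U₀) 2 MeasureTheory.volume ≤ ENNReal.ofReal r → ∀ (U : ℝ → UnitAddTorus (Fin 3) → EuclideanSpace ℝ (Fin 3)) (P : ℝ → UnitAddTorus (Fin 3) → ℝ), Literature.Analysis.FunctionSpaces.Torus.IsClassicalNSSolutionOn (Set.Icc 0 S) 0 (fun _ => f) U P → U 0 ≠ V) → ∃ (q τ ν₀ δ : ℝ), 0 < q ∧ 0 ≤ τ ∧ 0 < ν₀ ∧ 0 < δ ∧ ∀ (ν : ℝ) (u₀ : UnitAddTorus (Fin 3) → EuclideanSpace ℝ (Fin 3)) (u : ℝ → UnitAddTorus (Fin 3) → EuclideanSpace ℝ (Fin 3)), 0 < ν → ν < ν₀ → Literature.Analysis.FluidPDE.Torus.IsGlobalLerayHopf ν (fun _ => f) u₀ u → MeasureTheory.MemLp u₀ 2 MeasureTheory.volume → MeasureTheory.eLpNorm (u₀ - U₀) 2 MeasureTheory.volume ≤ ENNReal.ofReal δ → q ≤ ν * (MeasureTheory.lintegral (MeasureTheory.Measure.restrict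 MeasureTheory.volume (Set.Ioo 0 (S + τ))) (fun t => Literature.Analysis.FunctionSpaces.Torus.eGradNormSq (u t))).toReal) →
    UniformIgnition → RecurrentBlowupBall → SparksThesis := by
  intro hBall hUnif hRBB
  obtain ⟨f, hf, hfd, hfm, U₀, δ₁, δ₂, T, E, Tr, ν₁, hU₀, hU₀d, hδ₂, hδ₂₁, hT, hTr, hν₁, hball, hreturn⟩ := hRBB
  -- pointwise ignition at every smooth div-free V with ‖V − U₀‖ ≤ δ₁' := (δ₁ + δ₂)/2, via the sub-ball of radius (δ₁ − δ₂)/2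
  set δ₁' : ℝ := (δ₁ + δ₂) / 2 with hδ₁'def
  have hδ₁'pos : 0 < δ₁' := by rw [hδ₁'def]; linarith
  have hδ₂₁' : δ₂ < δ₁' := by rw [hδ₁'def]; linarith
  have hpoint : ∀ V : UnitAddTorus (Fin 3) → EuclideanSpace ℝ (Fin 3),
      Literature.Analysis.FunctionSpaces.Torus.IsSmooth V → Literature.Analysis.FunctionSpaces.Torus.IsDivFree V →
      MeasureTheory.eLpNorm (V - U₀) 2 MeasureTheory.volume ≤ ENNReal.ofReal δ₁' →
      ∃ (q Tb ν₀ δ : ℝ), 0 < q ∧ 0 < Tb ∧ 0 < ν₀ ∧ 0 < δ ∧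
        ∀ (ν : ℝ) (u₀ : UnitAddTorus (Fin 3) → EuclideanSpace ℝ (Fin 3)) (u : ℝ → UnitAddTorus (Fin 3) → EuclideanSpace ℝ (Fin 3)),
          0 < ν → ν < ν₀ → Literature.Analysis.FluidPDE.Torus.IsGlobalLerayHopf ν (fun _ => f) u₀ u →
          MeasureTheory.MemLp u₀ 2 MeasureTheory.volume →
          MeasureTheory.eLpNorm (u₀ - V) 2 MeasureTheory.volume ≤ ENNReal.ofReal δ →
          q ≤ ν * (MeasureTheory.lintegral (MeasureTheory.Measure.restrict MeasureTheory.volume (Set.Ioo 0 Tb))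
            (fun t => Literature.Analysis.FunctionSpaces.Torus.eGradNormSq (u t))).toReal := by
    intro V hV hVd hVclose
    -- the sub-ball B̄_{(δ₁−δ₂)/2}(V) lies in the blow-up ball B̄_{δ₁}(U₀)
    have hr : 0 < (δ₁ - δ₂) / 2 := by linarith
    have hsub : ∀ W : UnitAddTorus (Fin 3) → EuclideanSpace ℝ (Fin 3),
        Literature.Analysis.FunctionSpaces.Torus.IsSmooth W → Literature.Analysis.FunctionSpaces.Torus.IsDivFree W →
        MeasureTheory.eLpNorm (W - V) 2 MeasureTheory.volume ≤ ENNReal.ofReal ((δ₁ - δ₂) / 2) →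
        ∀ (U : ℝ → UnitAddTorus (Fin 3) → EuclideanSpace ℝ (Fin 3)) (P : ℝ → UnitAddTorus (Fin 3) → ℝ),
          Literature.Analysis.FunctionSpaces.Torus.IsClassicalNSSolutionOn (Set.Icc 0 T) 0 (fun _ => f) U P → U 0 ≠ W := by
      intro W hW hWd hWclose
      have hWm : AEStronglyMeasurable (W - V) volume :=
        (hW.memLp 2).aestronglyMeasurable.sub (hV.memLp 2).aestronglyMeasurable
      have hVm : AEStronglyMeasurable (V - U₀) volume :=
        (hV.memLp 2).aestronglyMeasurable.sub (hU₀.memLp 2).aestronglyMeasurable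
      have hWU₀ : MeasureTheory.eLpNorm (W - U₀) 2 MeasureTheory.volume ≤ ENNReal.ofReal δ₁ := by
        have hsplit : W - U₀ = (W - V) + (V - U₀) := by abel
        calc MeasureTheory.eLpNorm (W - U₀) 2 MeasureTheory.volume
            = MeasureTheory.eLpNorm ((W - V) + (V - U₀)) 2 MeasureTheory.volume := by rw [hsplit]
          _ ≤ MeasureTheory.eLpNorm (W - V) 2 MeasureTheory.volume + MeasureTheory.eLpNorm (V - U₀) 2 MeasureTheory.volume :=
              eLpNorm_add_le hWm hVm (by norm_num)
          _ ≤ ENNReal.ofReal ((δ₁ - δ₂) / 2) + ENNReal.ofReal δ₁' := add_le_add hWclose hVclose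
          _ = ENNReal.ofReal δ₁ := by
              rw [← ENNReal.ofReal_add hr.le hδ₁'pos.le]; congr 1; rw [hδ₁'def]; ring
      exact hball W hW hWd hWU₀
    obtain ⟨q, τ, ν₀, δ, hq, hτ, hν₀, hδ, hign⟩ := hBall f hf hfd hfm V hV hVd ((δ₁ - δ₂) / 2) T hr hT hsub
    exact ⟨q, T + τ, ν₀, δ, hq, by linarith, hν₀, hδ, hign⟩
  -- uniform ignition on B̄_{δ₂}(U₀)
  obtain ⟨q, Tb, ν₀, hq, hTb, hν₀, hunif⟩ := hUnif f hf hfd hfm U₀ hU₀ hU₀d δ₁' δ₂ hδ₂ hδ₂₁' hpoint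
  -- return time Tr' = N · Tr ≥ Tb
  obtain ⟨N, hN⟩ := exists_nat_gt (Tb / Tr)
  have hNpos : (0 : ℝ) < N := lt_trans (div_pos hTb hTr) hN
  have hN1 : (1 : ℝ) ≤ N := by
    have : (0 : ℕ) < N := by exact_mod_cast hNpos
    exact_mod_cast Nat.one_le_iff_ne_zero.mpr (Nat.pos_iff_ne_zero.mp this)
  have hTbN : Tb ≤ N * Tr := by
    have := (div_lt_iff₀ hTr).1 hN
    linarith
  refine ⟨f, hf, hfd, hfm, {U₀}, δ₂, q, E, Tb, N * Tr, min ν₀ ν₁, hδ₂, hq, hTb, hTbN, lt_min hν₀ hν₁, ?_, ?_⟩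
  · -- IGNITION near S = {U₀} at radius δ₂
    intro ν u₀ u hν hνlt hLH hmem hclose
    obtain ⟨U, hUS, hU⟩ := hclose
    rw [Set.mem_singleton_iff] at hUS
    subst hUS
    exact hunif ν u₀ u hν (lt_of_lt_of_le hνlt (min_le_left _ _)) hLH hmem hU
  · -- RETURN: deep returns of RecurrentBlowupBall, read in windows of length N · Tr
    intro ν hν hνlt
    obtain ⟨u₀, u, hLH, hE, hret⟩ := hreturn ν hν (lt_of_lt_of_le hνlt (min_le_right _ _))
    refine ⟨u₀, u, hLH, hE, fun k => ?_⟩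
    obtain ⟨s, hs, hrestart, hsclose⟩ := hret (k * N)
    refine ⟨s, ?_, hrestart, U₀, Set.mem_singleton U₀, hsclose⟩
    obtain ⟨hs1, hs2⟩ := hs
    constructor
    · -- k * (N * Tr) ≤ s
      have : ((k * N : ℕ) : ℝ) * Tr = (k : ℝ) * (N * Tr) := by push_cast; ring
      linarith
    · -- s ≤ (k + 1) * (N * Tr): ((kN) + 1) Tr ≤ (k+1) N Tr since N ≥ 1
      have h1 : (((k * N : ℕ) : ℝ) + 1) * Tr ≤ ((k : ℝ) + 1) * (N * Tr) := by
        push_cast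
        nlinarith [hTr, hN1]
      linarith

end Summit.AnomalousDissipation.AnomalousDissipation.Cruxes.SingularitiesDissipate.ReGlue

end
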